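import Literature.Claims.NS.Martila2023
import HarnessLib

/-!
# C59 `Martila2023` — kernel certificate for the NS-claims sweep (D-0090), refuter-8

Typed record: `Literature.Claims.NS.Martila2023` (typist-11 g2, p484120), D. Martila, Qeios 0K47T6 v1
(2023), 4 pp.: «counter-examples» against the equations — §2 p.3 «(4) contradicts (1)» and §3 pp.3–4
«Eq. (4) is not invariant under Galilean Coordinate Transformation».

Kernel facts (sorry-free, standard axioms; the one-line kit is typist-11 g2's, checked and filed under
landing convention (b)):

* `not_Step_2` — §3's non-invariance sentence is false as typed: (4) `ρ(∂ₜu + (u·∇)u) = f` IS Galilean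
  covariant once the transformation also moves the point (`boostVel w u (t, y) = u(t, y + t w) − w`; the time
  derivative at the moving point contributes `+Du[w]`, cancelling the `(w·∇)V` of the display (7), which is
  itself correct: `step_2lit_holds`) — kernel `galileanInvariant4_holds`.
* `not_Step_1` — §2's «(4) contradicts (1)» is false: the rest state with unit density and zero force
  satisfies both (1) and (4) (`solvesEq1_rest`, `solvesEq4_rest`).
* `not_ClaimedTheorem` — hence the typed claim `Step_1 ∨ Step_2` fails.

WHAT THIS IS NOT: not a claim about NS regularity or blow-up; not a claim about any author beyond the
typed locator.
-/

set_option linter.dupNamespace false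

open Literature.Claims.NS.Martila2023

namespace Summit.NavierStokesRegularity.NavierStokesRegularity.Theorems.Martila2023

/-- **§3 pp.3–4 «Eq. (4) is not invariant under Galilean Coordinate Transformation» is false (C59)**:
(4) is Galilean covariant (`galileanInvariant4_holds`). [cite: Martila2023NSQeios, §3 pp.3–4, display (7)] -/
theorem not_Step_2 : ¬ Literature.Claims.NS.Martila2023.Step_2 :=
  fun h => h galileanInvariant4_holds

/-- **§2 p.3 «(4) contradicts (1)» is false (C59)**: the rest state (ρ ≡ 1, f ≡ 0, u ≡ 0) satisfies (1)
and (4) simultaneously. [cite: Martila2023NSQeios, §2 p.3] -/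
theorem not_Step_1 : ¬ Literature.Claims.NS.Martila2023.Step_1 :=
  fun h => h _ _ _ solvesEq1_rest solvesEq4_rest

/-- **The typed claim (`Step_1 ∨ Step_2`, §1 p.2 «countless counter-examples against these equations») is
false (C59).** [cite: Martila2023NSQeios, §1 p.2] -/
theorem not_ClaimedTheorem : ¬ Literature.Claims.NS.Martila2023.ClaimedTheorem :=
  fun h => h.elim not_Step_1 not_Step_2

end Summit.NavierStokesRegularity.NavierStokesRegularity.Theorems.Martila2023
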